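import Summits.Parity.GeneralizedHardyLittlewood.Theorems.PrimeLevelFamEdgeMomentsBeyondDiagonalDiagRiesz
import HarnessLib

/-!
# Route `PrimeLevelFamEdge`, crux K_A `MomentsBeyondDiagonal` (stmt-Parity-20007), line «petersson_layers» v4, stub `stub_diag`:
# **the order-`c` coprime Selberg-coordinate sum** —
# `S⁽ᶜ⁾(y;n) = Σ_{k ≤ y, (k,n)=1} τ(k)W(k)·logᶜ(y/k) = c(c−1)·E_n·log^{c−2} y + O_c(D(n)(1 + log y)^{c−3})` (`c ≥ 3`)

Census item R3(i) of the `stub_diag` roadmap (generalising K_B's `KernelFormXSqCore` from the profile `X²`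
to `X^c`). The Selberg coordinates of the KMV mollifier with profile `P = Σ_{c≥2} p_c X^c` are
`A_n = W(n)·Σ_c p_c S⁽ᶜ⁾(M/n;n)/logᶜM` with `S⁽ᶜ⁾(y;n) = Σ_{k ≤ y,(k,n)=1} τ(k)W(k)logᶜ(y/k)`
(`W = μ/(id·ψ)`; the summand is `copTauW n k`). Writing `copTauW n = (G∗G) ∗ h_n` (`KernelFormXSqLocal`)
and rearranging, `S⁽ᶜ⁾(y;n) = Σ_{m ≤ y} h_n(m)·R⁽ᶜ⁾(y/m)` with `R⁽ᶜ⁾` the order-`c` logarithmic Riesz mean of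
`(μ∗μ)/id` (`…DiagRiesz`: `= c(c−1)log^{c−2} + O((1+log)^{c−3})`); since `Σ_m|h_n(m)|m^{1/8} ≪ D(n)`
(`KernelFormXSqLocalSum`) and `Σ_m h_n(m) = E_n` (`KernelFormXSqEuler`):

* `coprimeSumPow_eq_sum_hloc` — the rearrangement at every order `c`;
* `abs_sum_hloc_Icc_sub_mainConst_le` — the tail `|Σ_{m ≤ y} h_n(m) − E_n| ≤ y^{−1/8}·C_h D(n)`;
* `abs_coprimeSumPow_sub_le` — **`|S⁽ᶜ⁾(y;n) − c(c−1)E_n log^{c−2} y| ≤ C_c·D(n)·(1 + log y)^{c−3}`** for all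
  `y ≥ 1`, `n ≥ 1`, `c ≥ 3` (`E_n = mainConst n`, `D(n) = divWeight n`) — so `A_n ≈ W(n)E_n·P″(log(M/n)/log M)/log²M`
  to relative precision `O(1/log)`, the input of the `X^c × X^{c'}` terms of the kernel form (the `(2,2)` term
  is the tree's `abs_coprimeSum_sub_le`).

Def-free (the sums are written out; `mainConst`, `divWeight`, `copTauW`, `hloc` are the tree's); theorems only.
Helper `--supports stmt-Parity-20007`; closes nothing; K_A, K_B and the Parity summit are NOT proved; nothing
about Landau–Siegel zeros.

## References
* E. Kowalski, P. Michel, J. VanderKam, J. reine angew. Math. 526 (2000), Prop. 5.1 p. 18 (the residue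
  evaluation behind (31), here for `P = X^c` in real variables, uniformly in the coprimality modulus).
  [cite: KowalskiMichelVanderKam2000, Prop. 5.1 — derivation]
* H. L. Montgomery, R. C. Vaughan, *Multiplicative Number Theory I*, CUP 2007, §8.1. [cite: MontgomeryVaughan2007, §8.1 — derivation]
-/

noncomputable section

open scoped Real ArithmeticFunction.Moebius
open Finset ArithmeticFunction

namespace Summit.Parity.GeneralizedHardyLittlewood.Theorems.MomentsBeyondDiagonal.DiagKernel

open Literature.NumberTheory.LFunctions Literature.NumberTheory.LFunctions.KMV2000
open MollifierMainTerm (G)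
open Literature.Barriers.Parity (Icc_one_eq_Ioc_zero)
open Summit.Parity.GeneralizedHardyLittlewood.Theorems.BeyondDiagonalBeatsQuarter.KernelFormXSq
  (copTauW hloc mainConst divWeight divWeight_nonneg copTauW_eq_G_mul_G_mul_hloc hasSum_hloc summable_hloc
    summable_abs_hloc_mul_rpow tsum_abs_hloc_mul_rpow_le abs_hloc_le_mul_rpow)

/-! ### The rearrangement `S⁽ᶜ⁾(y;n) = Σ_{m ≤ y} h_n(m)·R⁽ᶜ⁾(y/m)` -/

/-- **`S⁽ᶜ⁾(y;n) = Σ_{m ≤ y} h_n(m)·R⁽ᶜ⁾(y/m)`** at every order `c` (Dirichlet's rearrangement of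
`copTauW n = h_n ∗ (G∗G)`), `R⁽ᶜ⁾(t) = Σ_{j ≤ t} (G∗G)(j) logᶜ(t/j)`.
[cite: KowalskiMichelVanderKam2000, Prop. 5.1 — derivation] -/
theorem coprimeSumPow_eq_sum_hloc (n c : ℕ) (y : ℝ) :
    ∑ k ∈ Icc 1 ⌊y⌋₊, copTauW n k * Real.log (y / k) ^ c =
      ∑ m ∈ Icc 1 ⌊y⌋₊, hloc n m *
        ∑ j ∈ Icc 1 ⌊y / m⌋₊, (G * G) j * Real.log (y / m / j) ^ c := by
  classical
  rw [copTauW_eq_G_mul_G_mul_hloc, mul_comm (G * G) (hloc n), Icc_one_eq_Ioc_zero]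
  have h1 : ∑ k ∈ Ioc 0 ⌊y⌋₊, (hloc n * (G * G)) k * Real.log (y / k) ^ c =
      ∑ k ∈ Ioc 0 ⌊y⌋₊, ∑ x ∈ k.divisorsAntidiagonal,
        hloc n x.1 * (G * G) x.2 * Real.log (y / ((x.1 * x.2 : ℕ) : ℝ)) ^ c := by
    refine Finset.sum_congr rfl fun k _ ↦ ?_
    rw [mul_apply, Finset.sum_mul]
    refine Finset.sum_congr rfl fun x hx ↦ ?_
    rw [(Nat.mem_divisorsAntidiagonal.1 hx).1]
  rw [h1, SiegelWalfiszLiouville.sum_Ioc_sum_divisorsAntidiagonal_eq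
    (fun a b ↦ hloc n a * (G * G) b * Real.log (y / ((a * b : ℕ) : ℝ)) ^ c) ⌊y⌋₊]
  refine Finset.sum_congr rfl fun m _ ↦ ?_
  rw [Nat.floor_div_natCast, Icc_one_eq_Ioc_zero, Finset.mul_sum]
  refine Finset.sum_congr rfl fun j _ ↦ ?_
  push_cast
  rw [div_div]
  ring

/-! ### Elementary inequalities -/

/-- `b^{k+1} − a^{k+1} ≤ (k+1)(b − a)bᵏ` for `0 ≤ a ≤ b`. [folklore] -/
theorem pow_succ_sub_pow_succ_le {a b : ℝ} (ha : 0 ≤ a) (hab : a ≤ b) (k : ℕ) :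
    b ^ (k + 1) - a ^ (k + 1) ≤ (k + 1 : ℝ) * (b - a) * b ^ k := by
  induction k with
  | zero => simp
  | succ k ih =>
    have hb : 0 ≤ b := ha.trans hab
    have hak : a ^ (k + 1) ≤ b ^ (k + 1) := pow_le_pow_left₀ ha hab _
    have e : b ^ (k + 1 + 1) - a ^ (k + 1 + 1) =
        b * (b ^ (k + 1) - a ^ (k + 1)) + a ^ (k + 1) * (b - a) := by ring
    rw [e]
    have h1 : b * (b ^ (k + 1) - a ^ (k + 1)) ≤ b * ((k + 1 : ℝ) * (b - a) * b ^ k) :=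
      mul_le_mul_of_nonneg_left ih hb
    have h2 : a ^ (k + 1) * (b - a) ≤ b ^ (k + 1) * (b - a) :=
      mul_le_mul_of_nonneg_right hak (by linarith)
    push_cast
    calc _ ≤ b * ((k + 1 : ℝ) * (b - a) * b ^ k) + b ^ (k + 1) * (b - a) := add_le_add h1 h2
      _ = ((k : ℝ) + 1 + 1) * (b - a) * b ^ (k + 1) := by ring

/-- `log x ≤ 8·x^{1/8}` for `x ≥ 0`. [folklore] -/
theorem log_le_eight_mul_rpow {x : ℝ} (hx : 0 ≤ x) : Real.log x ≤ 8 * x ^ (1 / 8 : ℝ) := by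
  have h := Real.log_le_rpow_div hx (by norm_num : (0 : ℝ) < 1 / 8)
  linarith

/-! ### The tail of `Σ h_n = E_n` -/

/-- **`|Σ_{m ≤ y} h_n(m) − E_n| ≤ y^{−1/8}·C_h·D(n)`** for `y ≥ 1`, `n ≥ 1`, where `C_h` is the constant of
`Σ_m |h_n(m)|m^{1/8} ≤ C_h D(n)` (`tsum_abs_hloc_mul_rpow_le`). [folklore] -/
theorem abs_sum_hloc_Icc_sub_mainConst_le {C_h : ℝ}
    (hH : ∀ n : ℕ, n ≠ 0 → ∑' m : ℕ, |hloc n m| * (m : ℝ) ^ (1 / 8 : ℝ) ≤ C_h * divWeight n)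
    {n : ℕ} (hn : n ≠ 0) {y : ℝ} (hy : 1 ≤ y) :
    |∑ m ∈ Icc 1 ⌊y⌋₊, hloc n m - mainConst n| ≤ y ^ (-(1 / 8 : ℝ)) * (C_h * divWeight n) := by
  have hy0 : 0 < y := by linarith
  set N : ℕ := ⌊y⌋₊ with hN
  have hyN : y < N + 1 := Nat.lt_floor_add_one y
  set D : ℝ := divWeight n with hDdef
  have hHn : ∑' m : ℕ, |hloc n m| * (m : ℝ) ^ (1 / 8 : ℝ) ≤ C_h * D := hH n hn
  have hsw := summable_abs_hloc_mul_rpow hn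
  have hsh := summable_hloc hn
  have hE : mainConst n = ∑ m ∈ Icc 1 N, hloc n m + ∑' i, hloc n (i + (N + 1)) := by
    rw [mainConst, ← (hasSum_hloc hn).tsum_eq,
      ← Summable.sum_add_tsum_nat_add (f := fun m ↦ hloc n m) (N + 1) hsh]
    congr 1
    have hr : Finset.range (N + 1) = insert 0 (Icc 1 N) := by
      ext m; simp only [Finset.mem_range, Finset.mem_insert, Finset.mem_Icc]; omega
    rw [hr, Finset.sum_insert (by simp), ArithmeticFunction.map_zero, zero_add]
  have hdec : ∑ m ∈ Icc 1 N, hloc n m - mainConst n = -∑' i, hloc n (i + (N + 1)) := by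
    rw [hE]; ring
  rw [hdec, abs_neg]
  set f : ℕ → ℝ := fun m ↦ hloc n m with hf
  set w : ℕ → ℝ := fun m ↦ |hloc n m| * (m : ℝ) ^ (1 / 8 : ℝ) with hw
  have hsh' : Summable f := hsh
  have hsw' : Summable w := hsw
  have hst : Summable fun i ↦ f (i + (N + 1)) := (summable_nat_add_iff (N + 1)).2 hsh'
  have hswt : Summable fun i ↦ w (i + (N + 1)) := (summable_nat_add_iff (N + 1)).2 hsw'
  have hy8 : 0 < y ^ (1 / 8 : ℝ) := by positivity
  have hpt : ∀ i, |f (i + (N + 1))| ≤ y ^ (-(1 / 8 : ℝ)) * w (i + (N + 1)) := by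
    intro i
    simp only [hf, hw]
    have hiy : y ≤ ((i + (N + 1) : ℕ) : ℝ) := by push_cast; linarith
    have h8 : y ^ (1 / 8 : ℝ) ≤ ((i + (N + 1) : ℕ) : ℝ) ^ (1 / 8 : ℝ) :=
      Real.rpow_le_rpow hy0.le hiy (by norm_num)
    rw [Real.rpow_neg hy0.le, ← div_eq_inv_mul, le_div_iff₀ hy8]
    exact mul_le_mul_of_nonneg_left h8 (abs_nonneg _)
  have htail : ∑' i, w (i + (N + 1)) ≤ C_h * D := by
    refine le_trans ?_ hHn
    have h := hsw'.sum_add_tsum_nat_add (N + 1)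
    have hnn : 0 ≤ ∑ i ∈ Finset.range (N + 1), w i :=
      Finset.sum_nonneg fun i _ ↦ by simp only [hw]; positivity
    change ∑' i, w (i + (N + 1)) ≤ ∑' m, w m
    linarith
  have hup : ∑' i, f (i + (N + 1)) ≤ ∑' i, |f (i + (N + 1))| :=
    hst.tsum_le_tsum (fun i ↦ le_abs_self _) hst.abs
  have hdown : -∑' i, |f (i + (N + 1))| ≤ ∑' i, f (i + (N + 1)) := by
    rw [← tsum_neg]
    exact hst.abs.neg.tsum_le_tsum (fun i ↦ neg_abs_le _) hst
  have habs : |∑' i, f (i + (N + 1))| ≤ ∑' i, |f (i + (N + 1))| := abs_le.2 ⟨hdown, hup⟩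
  have hcmp : ∑' i, |f (i + (N + 1))| ≤ ∑' i, y ^ (-(1 / 8 : ℝ)) * w (i + (N + 1)) :=
    hst.abs.tsum_le_tsum hpt (hswt.mul_left _)
  change |∑' i, f (i + (N + 1))| ≤ _
  calc |∑' i, f (i + (N + 1))| ≤ ∑' i, |f (i + (N + 1))| := habs
    _ ≤ ∑' i, y ^ (-(1 / 8 : ℝ)) * w (i + (N + 1)) := hcmp
    _ = y ^ (-(1 / 8 : ℝ)) * ∑' i, w (i + (N + 1)) := tsum_mul_left
    _ ≤ y ^ (-(1 / 8 : ℝ)) * (C_h * D) := mul_le_mul_of_nonneg_left htail (by positivity)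

/-! ### The core bound at order `m + 3` -/

/-- The order-`(m+3)` core bound with the inner Riesz means abstracted: if
`|F(t) − (m+3)(m+2)log^{m+1} t| ≤ C_R(1 + log t)^m` for `t ≥ 1`, then
`|Σ_{k ≤ y} h_n(k)F(y/k) − (m+3)(m+2)E_n log^{m+1} y| ≤ C_h(C_R + 8(m+3)²(m+2))·D(n)(1 + log y)^m`.
[cite: KowalskiMichelVanderKam2000, Prop. 5.1 — derivation] -/
theorem abs_sum_hloc_mul_sub_le_of_order {C_R C_h : ℝ} (hC_R : 0 ≤ C_R) (m : ℕ)
    (hH : ∀ n : ℕ, n ≠ 0 → ∑' k : ℕ, |hloc n k| * (k : ℝ) ^ (1 / 8 : ℝ) ≤ C_h * divWeight n)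
    {F : ℝ → ℝ}
    (hF : ∀ t : ℝ, 1 ≤ t → |F t - ((m : ℝ) + 3) * ((m : ℝ) + 2) * Real.log t ^ (m + 1)| ≤
      C_R * (1 + Real.log t) ^ m)
    {n : ℕ} (hn : n ≠ 0) {y : ℝ} (hy : 1 ≤ y) :
    |∑ k ∈ Icc 1 ⌊y⌋₊, hloc n k * F (y / k) -
        ((m : ℝ) + 3) * ((m : ℝ) + 2) * mainConst n * Real.log y ^ (m + 1)| ≤
      C_h * (C_R + 8 * (((m : ℝ) + 3) * ((m : ℝ) + 2)) * ((m : ℝ) + 3)) * divWeight n *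
        (1 + Real.log y) ^ m := by
  have hy0 : 0 < y := by linarith
  set N : ℕ := ⌊y⌋₊ with hN
  set L : ℝ := Real.log y with hLdef
  have hL : 0 ≤ L := Real.log_nonneg hy
  have hNy : (N : ℝ) ≤ y := Nat.floor_le hy0.le
  set D : ℝ := divWeight n with hDdef
  have hD0 : 0 ≤ D := divWeight_nonneg n
  set A : ℝ := ((m : ℝ) + 3) * ((m : ℝ) + 2) with hAdef
  have hA0 : 0 ≤ A := by positivity
  have hHn : ∑' k : ℕ, |hloc n k| * (k : ℝ) ^ (1 / 8 : ℝ) ≤ C_h * D := hH n hn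
  have hCh0 : 0 ≤ C_h * D := le_trans (tsum_nonneg fun k ↦ by positivity) hHn
  have hsw := summable_abs_hloc_mul_rpow hn
  -- decomposition
  have hdec : ∑ k ∈ Icc 1 N, hloc n k * F (y / k) - A * mainConst n * L ^ (m + 1) =
      ∑ k ∈ Icc 1 N, hloc n k * (F (y / k) - A * L ^ (m + 1)) +
        A * L ^ (m + 1) * (∑ k ∈ Icc 1 N, hloc n k - mainConst n) := by
    have : ∑ k ∈ Icc 1 N, hloc n k * (F (y / k) - A * L ^ (m + 1)) =
        ∑ k ∈ Icc 1 N, hloc n k * F (y / k) - A * L ^ (m + 1) * ∑ k ∈ Icc 1 N, hloc n k := by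
      rw [Finset.mul_sum, ← Finset.sum_sub_distrib]
      exact Finset.sum_congr rfl fun k _ ↦ by ring
    rw [this]; ring
  -- pointwise bound
  have hpt : ∀ k ∈ Icc 1 N, |hloc n k * (F (y / k) - A * L ^ (m + 1))| ≤
      (C_R + 8 * A * ((m : ℝ) + 2)) * (1 + L) ^ m * (|hloc n k| * (k : ℝ) ^ (1 / 8 : ℝ)) := by
    intro k hk
    have hk' := Finset.mem_Icc.1 hk
    have hk0 : (0 : ℝ) < k := by exact_mod_cast hk'.1
    have hk1 : (1 : ℝ) ≤ k := by exact_mod_cast hk'.1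
    have hky : (k : ℝ) ≤ y := le_trans (by exact_mod_cast hk'.2) hNy
    have hyk : 1 ≤ y / k := by rw [le_div_iff₀ hk0]; linarith
    have hk8 : 1 ≤ (k : ℝ) ^ (1 / 8 : ℝ) := Real.one_le_rpow hk1 (by norm_num)
    have hlogk : 0 ≤ Real.log k := Real.log_nonneg hk1
    have hlogk8 : Real.log k ≤ 8 * (k : ℝ) ^ (1 / 8 : ℝ) := log_le_eight_mul_rpow hk0.le
    -- `log(y/k) = L - log k`, `0 ≤ log(y/k) ≤ L`
    have hlyk : Real.log (y / k) = L - Real.log k := by rw [Real.log_div hy0.ne' hk0.ne']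
    have hlyk0 : 0 ≤ Real.log (y / k) := Real.log_nonneg hyk
    have hlykL : Real.log (y / k) ≤ L := by rw [hlyk]; linarith
    have h1 : |F (y / k) - A * Real.log (y / k) ^ (m + 1)| ≤ C_R * (1 + L) ^ m := by
      refine (hF (y / k) hyk).trans (mul_le_mul_of_nonneg_left ?_ hC_R)
      exact pow_le_pow_left₀ (by linarith) (by linarith) m
    have h2 : |A * Real.log (y / k) ^ (m + 1) - A * L ^ (m + 1)| ≤
        A * (((m : ℝ) + 1) * Real.log k * L ^ m) := by
      rw [← mul_sub, abs_mul, abs_of_nonneg hA0, abs_sub_comm]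
      refine mul_le_mul_of_nonneg_left ?_ hA0
      rw [abs_of_nonneg (by nlinarith [pow_le_pow_left₀ hlyk0 hlykL (m + 1)])]
      have := pow_succ_sub_pow_succ_le hlyk0 hlykL m
      rw [hlyk] at this ⊢
      calc L ^ (m + 1) - (L - Real.log k) ^ (m + 1) ≤ (m + 1 : ℝ) * (L - (L - Real.log k)) * L ^ m := this
        _ = ((m : ℝ) + 1) * Real.log k * L ^ m := by ring
    have h3 : |F (y / k) - A * L ^ (m + 1)| ≤ C_R * (1 + L) ^ m + A * (((m : ℝ) + 1) * Real.log k * L ^ m) := by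
      calc |F (y / k) - A * L ^ (m + 1)|
          = |(F (y / k) - A * Real.log (y / k) ^ (m + 1)) + (A * Real.log (y / k) ^ (m + 1) - A * L ^ (m + 1))| := by
            ring_nf
        _ ≤ _ := abs_add_le _ _
        _ ≤ _ := add_le_add h1 h2
    have hLm : L ^ m ≤ (1 + L) ^ m := pow_le_pow_left₀ hL (by linarith) m
    have h4 : C_R * (1 + L) ^ m + A * (((m : ℝ) + 1) * Real.log k * L ^ m) ≤
        (C_R + 8 * A * ((m : ℝ) + 2)) * (1 + L) ^ m * (k : ℝ) ^ (1 / 8 : ℝ) := by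
      have e1 : C_R * (1 + L) ^ m ≤ C_R * (1 + L) ^ m * (k : ℝ) ^ (1 / 8 : ℝ) :=
        le_mul_of_one_le_right (by positivity) hk8
      have e2 : A * (((m : ℝ) + 1) * Real.log k * L ^ m) ≤
          8 * A * ((m : ℝ) + 2) * (1 + L) ^ m * (k : ℝ) ^ (1 / 8 : ℝ) := by
        have : ((m : ℝ) + 1) * Real.log k * L ^ m ≤ ((m : ℝ) + 2) * (8 * (k : ℝ) ^ (1 / 8 : ℝ)) * (1 + L) ^ m := by
          have hm12 : ((m : ℝ) + 1) ≤ (m : ℝ) + 2 := by linarith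
          calc ((m : ℝ) + 1) * Real.log k * L ^ m ≤ ((m : ℝ) + 2) * Real.log k * L ^ m := by
                gcongr
            _ ≤ ((m : ℝ) + 2) * (8 * (k : ℝ) ^ (1 / 8 : ℝ)) * L ^ m := by gcongr
            _ ≤ ((m : ℝ) + 2) * (8 * (k : ℝ) ^ (1 / 8 : ℝ)) * (1 + L) ^ m := by gcongr
        calc A * (((m : ℝ) + 1) * Real.log k * L ^ m)
            ≤ A * (((m : ℝ) + 2) * (8 * (k : ℝ) ^ (1 / 8 : ℝ)) * (1 + L) ^ m) :=
              mul_le_mul_of_nonneg_left this hA0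
          _ = 8 * A * ((m : ℝ) + 2) * (1 + L) ^ m * (k : ℝ) ^ (1 / 8 : ℝ) := by ring
      calc _ ≤ C_R * (1 + L) ^ m * (k : ℝ) ^ (1 / 8 : ℝ) +
            8 * A * ((m : ℝ) + 2) * (1 + L) ^ m * (k : ℝ) ^ (1 / 8 : ℝ) := add_le_add e1 e2
        _ = _ := by ring
    rw [abs_mul]
    calc |hloc n k| * |F (y / k) - A * L ^ (m + 1)|
        ≤ |hloc n k| * ((C_R + 8 * A * ((m : ℝ) + 2)) * (1 + L) ^ m * (k : ℝ) ^ (1 / 8 : ℝ)) :=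
          mul_le_mul_of_nonneg_left (h3.trans h4) (abs_nonneg _)
      _ = _ := by ring
  have hfin : ∑ k ∈ Icc 1 N, |hloc n k| * (k : ℝ) ^ (1 / 8 : ℝ) ≤ C_h * D :=
    (hsw.sum_le_tsum (Icc 1 N) fun k _ ↦ by positivity).trans hHn
  have hW : |∑ k ∈ Icc 1 N, hloc n k * (F (y / k) - A * L ^ (m + 1))| ≤
      (C_R + 8 * A * ((m : ℝ) + 2)) * (1 + L) ^ m * (C_h * D) := by
    refine (Finset.abs_sum_le_sum_abs _ _).trans ((Finset.sum_le_sum hpt).trans ?_)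
    rw [← Finset.mul_sum]
    exact mul_le_mul_of_nonneg_left hfin (by positivity)
  -- the tail term
  have hT : |∑ k ∈ Icc 1 N, hloc n k - mainConst n| ≤ y ^ (-(1 / 8 : ℝ)) * (C_h * D) :=
    abs_sum_hloc_Icc_sub_mainConst_le hH hn hy
  have hLy : L * y ^ (-(1 / 8 : ℝ)) ≤ 8 := by
    have h8 : L ≤ 8 * y ^ (1 / 8 : ℝ) := log_le_eight_mul_rpow hy0.le
    have hy8 : 0 < y ^ (1 / 8 : ℝ) := by positivity
    rw [Real.rpow_neg hy0.le, ← div_eq_mul_inv, div_le_iff₀ hy8]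
    linarith
  have hT' : |A * L ^ (m + 1) * (∑ k ∈ Icc 1 N, hloc n k - mainConst n)| ≤
      8 * A * (1 + L) ^ m * (C_h * D) := by
    rw [abs_mul, abs_of_nonneg (by positivity : (0 : ℝ) ≤ A * L ^ (m + 1))]
    have hLm : L ^ m ≤ (1 + L) ^ m := pow_le_pow_left₀ hL (by linarith) m
    calc A * L ^ (m + 1) * |∑ k ∈ Icc 1 N, hloc n k - mainConst n|
        ≤ A * L ^ (m + 1) * (y ^ (-(1 / 8 : ℝ)) * (C_h * D)) :=
          mul_le_mul_of_nonneg_left hT (by positivity)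
      _ = A * L ^ m * (L * y ^ (-(1 / 8 : ℝ))) * (C_h * D) := by ring
      _ ≤ A * (1 + L) ^ m * 8 * (C_h * D) := by
          have : A * L ^ m * (L * y ^ (-(1 / 8 : ℝ))) ≤ A * (1 + L) ^ m * 8 := by
            gcongr
          exact mul_le_mul_of_nonneg_right this hCh0
      _ = 8 * A * (1 + L) ^ m * (C_h * D) := by ring
  rw [hdec]
  calc |∑ k ∈ Icc 1 N, hloc n k * (F (y / k) - A * L ^ (m + 1)) +
          A * L ^ (m + 1) * (∑ k ∈ Icc 1 N, hloc n k - mainConst n)|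
      ≤ |∑ k ∈ Icc 1 N, hloc n k * (F (y / k) - A * L ^ (m + 1))| +
          |A * L ^ (m + 1) * (∑ k ∈ Icc 1 N, hloc n k - mainConst n)| := abs_add_le _ _
    _ ≤ (C_R + 8 * A * ((m : ℝ) + 2)) * (1 + L) ^ m * (C_h * D) + 8 * A * (1 + L) ^ m * (C_h * D) :=
        add_le_add hW hT'
    _ = C_h * (C_R + 8 * A * ((m : ℝ) + 3)) * D * (1 + L) ^ m := by rw [hAdef]; ring

/-- **`|S⁽ᵐ⁺³⁾(y;n) − (m+3)(m+2)E_n log^{m+1} y| ≤ C·D(n)(1 + log y)^m`** for all `y ≥ 1`, `n ≥ 1`.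
[cite: KowalskiMichelVanderKam2000, Prop. 5.1 — derivation (profile `X^{m+3}`, uniform in the coprimality modulus)] -/
theorem abs_coprimeSumPow_add_three_sub_le (m : ℕ) :
    ∃ C : ℝ, 0 < C ∧ ∀ n : ℕ, n ≠ 0 → ∀ y : ℝ, 1 ≤ y →
      |∑ k ∈ Icc 1 ⌊y⌋₊, copTauW n k * Real.log (y / k) ^ (m + 3) -
          ((m : ℝ) + 3) * ((m : ℝ) + 2) * mainConst n * Real.log y ^ (m + 1)| ≤
        C * divWeight n * (1 + Real.log y) ^ m := by
  obtain ⟨C_R, hC_R, hR⟩ := abs_flatRiesz_add_three_sub_le m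
  obtain ⟨C_h, hC_h, hH⟩ := tsum_abs_hloc_mul_rpow_le
  refine ⟨C_h * (C_R + 8 * (((m : ℝ) + 3) * ((m : ℝ) + 2)) * ((m : ℝ) + 3)), by positivity,
    fun n hn y hy ↦ ?_⟩
  rw [coprimeSumPow_eq_sum_hloc]
  exact abs_sum_hloc_mul_sub_le_of_order hC_R.le m (fun n hn ↦ hH n hn)
    (F := fun t ↦ ∑ j ∈ Icc 1 ⌊t⌋₊, (G * G) j * Real.log (t / j) ^ (m + 3)) hR hn hy

/-- **The order-`c` coprime Selberg-coordinate sum** (`c ≥ 3`): with an absolute `C_c`,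
`|Σ_{k ≤ y,(k,n)=1} τ(k)W(k)logᶜ(y/k) − c(c−1)·E_n·log^{c−2} y| ≤ C_c·D(n)·(1 + log y)^{c−3}` for all `y ≥ 1`,
`n ≥ 1` (`E_n = ζ(2)∏_{p∣n}(p+1)/(p−1)`, `D(n) = Σ_{d∣n}d^{−3/4}`).
[cite: KowalskiMichelVanderKam2000, Prop. 5.1 — derivation (profile `X^c`, uniform in the coprimality modulus)] -/
theorem abs_coprimeSumPow_sub_le {c : ℕ} (hc : 3 ≤ c) :
    ∃ C : ℝ, 0 < C ∧ ∀ n : ℕ, n ≠ 0 → ∀ y : ℝ, 1 ≤ y →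
      |∑ k ∈ Icc 1 ⌊y⌋₊, copTauW n k * Real.log (y / k) ^ c -
          (c : ℝ) * ((c : ℝ) - 1) * mainConst n * Real.log y ^ (c - 2)| ≤
        C * divWeight n * (1 + Real.log y) ^ (c - 3) := by
  obtain ⟨m, rfl⟩ : ∃ m, c = m + 3 := ⟨c - 3, by omega⟩
  obtain ⟨C, hC, h⟩ := abs_coprimeSumPow_add_three_sub_le m
  refine ⟨C, hC, fun n hn y hy ↦ ?_⟩
  have e1 : m + 3 - 2 = m + 1 := by omega
  have e2 : m + 3 - 3 = m := by omega
  rw [e1, e2]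
  have := h n hn y hy
  push_cast
  rw [show ((m : ℝ) + 3) * ((m : ℝ) + 3 - 1) = ((m : ℝ) + 3) * ((m : ℝ) + 2) by ring]
  exact this

end Summit.Parity.GeneralizedHardyLittlewood.Theorems.MomentsBeyondDiagonal.DiagKernel

end
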